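import Summits.HubbardSuperconductivity.HubbardSuperconductivity.Theses.LogColdTorus
import Summits.HubbardSuperconductivity.HubbardSuperconductivity.Theorems.BalabanIRBirEveryGroundStateClosures
import Summits.HubbardSuperconductivity.HubbardSuperconductivity.Theorems.LogColdTorusAverageToEveryStubSchurScalarOnGround
import Summits.HubbardSuperconductivity.HubbardSuperconductivity.Theorems.LogColdTorusAverageToEveryStubBlockAverageWitness
import Summits.HubbardSuperconductivity.HubbardSuperconductivity.Theorems.LogColdTorusAverageToEveryHalfFilling
import Summits.HubbardSuperconductivity.HubbardSuperconductivity.Theorems.LogColdTorusAverageToEveryRegimes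
import Summits.HubbardSuperconductivity.HubbardSuperconductivity.Theorems.LogColdTorusAverageToEveryRegimeMap
import HarnessLib

/-!
# Crux `AverageToEvery` (stmt-HubbardSuperconductivity-10519; route `LogColdTorus` rank 4, shared with
route `AbelianDuality` rank 5) — SKELETON of line `birth` (lead c14: `:=`-free stub signatures; stubs 2 (p147012) and 3 (p148193) LANDED and imported; lead c15, reshape r2: the BET restricted to the DOPED range `0 < |δ| < 1` — the fillings `δ = 0` (Lieb Thm 2, p151783) and `|δ| ≥ 1` (p152046) are LANDED theorems; lead c20, reshape r3: the BET further restricted to the LIVE REGION of the regime map — Yang `c ≤ 2(1-δ)(1+δ)` and carrier `c ≤ 80δ + 640/U₂` for `δ ≥ 0`, pairing-cost floor `c/(10⁵log²(4+32/√c)) ≤ U₁`, weak-coupling ceiling `c ≤ 10⁵U₁log²(4+32/√U₁)` — which the composition discharges by the LANDED `Theorems.blockWindow_regimeMap` (p163215); ONE open stub = the live doped BET)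

THE CRUX (fixed; `Theses/LogColdTorus.lean`, decl `AverageToEvery`, not restated here): for all
`δ, 0 < U₁ < U₂, c > 0, L₀` — if for every coupling `U` of the window `(U₁, U₂)` and every even side
`L ≥ L₀` the tracial sector GROUND-STATE AVERAGE of `Δ_d† Δ_d` is `≥ c L⁴` (BLOCK form:
`Matrix.groundStateFunctional` of `hubbardTorus 2 L 1 U` compressed by `Matrix.toBlock p p` to the
occupation sets `s` with `#s = N_L = 2⌊(1-δ)L²/2⌋` and `2·#{↑ ∈ s} = N_L`), then at SOME `U` of the
window EVERY admissible sequence of normalised `(N_L, S^z = 0)`-sector ground states has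
`d_{x²-y²}` pair-field long-range order along even sides (the summit's body at `(U, δ)`).

THE LINE (the crux's own stated mechanism, Kato–Rellich genericity + Schur, cut at its three
natural joints; cards `generic-u-schur-every-gs`, `commutant-schur-pair-invariance`). Reshape r1
(lead c14, 2026-08-17): the three stub SIGNATURES are restated WITHOUT `let … := …` binders (the
stub registrar cuts a signature at its first `:=`, so `let`-bearing stubs could never be matched by
`propose --supports`; this is why seats c1–c13 landed nothing). Mathematical content unchanged,
except that stubs 2 and 3 are stated for a general even particle number `2n` / general `N`
(specialised to `N_L` in the composition).

1. `stub_liveDopedCountableAccidentalCouplings` — THE BET (window-relative; reshape r3, lead c20: ONLY the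
   DOPED fillings `0 < |δ| < 1` AND ONLY data inside the regime map of the window hypothesis — for `δ ≥ 0`
   `c ≤ 2(1-δ)(1+δ)` (Yang) and `c ≤ 80δ + 640/U₂` (carrier), and `c/(10⁵log²(4+32/√c)) ≤ U₁`,
   `c ≤ 10⁵U₁log²(4+32/√U₁)` (pairing cost): OFF the map the window hypothesis is refuted by the landed
   `Theorems.blockWindow_regimeMap`, so the composition supplies these three hypotheses for free; reshape r2,
   lead c15: ONLY the doped fillings — the former `stub_countableAccidentalCouplings` quantified over every
   real `δ`, but its slices `δ = 0` (Lieb's Theorem 2: `Theorems.irreducibleGround_halfFilling`,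
   p151783) and `|δ| ≥ 1` (vacuum ray / full ray / empty sector:
   `Theorems.irreducibleGround_of_one_le_abs`, p152046) are now LANDED THEOREMS with empty
   exceptional sets, and the composition discharges them): for `0 < |δ| < 1`, under the crux's
   window hypothesis there are a threshold `L₁` and COUNTABLE exceptional sets `B L ⊂ ℝ` such that
   for every even `L ≥ L₁` and every coupling `U ∈ (U₁, U₂) ∖ B L` the sector ground eigenspace
   `E₀(U, L) = szSector N_L 0 ⊓ ker (H - e₀)`, `e₀ = minEnergyOn H (szSector N_L 0)`,
   `H = hubbardTorus 2 L 1 U`, is IRREDUCIBLE under the joint commutant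
   `{X | [X,H] = [X,N̂] = [X,S^z] = [X,Δ_d†Δ_d] = 0}` (it contains the lattice translations, the
   point group `D₄`, spin rotations, time reversal ∘ these — the weakest symmetry-type residual,
   cf. `Theorems.birEveryGroundState_of_irreducibleGround`). Per side this is "accidental
   (symmetry-unexplained) degeneracy of the doped `(N_L, 0)` floor happens at countably many
   couplings only" — the analytic-branch picture of the affine Hermitian pencil `T + U·D`
   (Kato 1966 II §6.1) minus SYSTEMATIC all-`U` reducibility, which is known to occur at the
   anomalous side `L = 4` only (hypercube automorphisms of the 4×4 torus; sibling-crux evidence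
   `Cruxes/BirEveryGroundState/Disproof.lean: not_pointwiseTransfer_L4`), hence `L₁`.
   Why it might fail: the crux's own why-might-fail — systematic multiplicity of inequivalent
   constituents along infinitely many even `L`; the MODEL-FREE version is false
   (`not_abstractDarkPartnerExclusion`, 5×5 integer pencil). Size: crux-sized (the residual).
2. `stub_schurScalarOnGround` — SCHUR (theorem-grade, M): for any coupling `U`, side `L` and
   particle number `N`, irreducibility of `E₀ = szSector N 0 ⊓ ker (H - e₀)` under the joint
   commutant ⇒ `Δ_d† Δ_d` has SCALAR matrix elements on `E₀`. Leans on: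
   `Theorems.exists_scalar_matrixElements_of_irreducible`,
   `Theorems.mulVec_mem_groundEigenspace_of_commute`, `Theorems.conjTranspose_mem_symmetries`.
3. `stub_blockAverageWitness` — BLOCK ↔ FOCK DICTIONARY (provable now, M): for any `U`, side `L`,
   `n` and `c > 0`: if the tracial ground-state functional of the compression of `H` to the
   occupation block `#s = 2n ∧ 2·#{↑ ∈ s} = 2n` gives the compressed `Δ_d† Δ_d` a real part
   `≥ c L⁴`, then SOME normalised Fock-space sector ground state `ψ`
   (`IsGroundStateInSector H (2n) 0 ψ`) has `c L⁴ ≤ re ⟨ψ, Δ_d† Δ_d ψ⟩` (`c > 0` forces a non-empty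
   block; pigeonhole over an orthonormal basis of the block ground space
   (`exists_unit_le_re_of_trace_projMatrix_map`); extension by zero of a block ground vector is a
   sector ground state: `szSector (2n) 0` is the coordinate subspace of the block
   (`mem_szSector_two_mul_zero_iff`, `JosephsonMirror.card_upPart_eq_card_filter`) and the block
   ground energy is `minEnergyOn` (`CwThesis.groundEnergy_toBlock_eq_minEnergyOn`)).

COMPOSITION `AverageToEvery_of : AverageToEvery` (A12: concludes the crux BY NAME, cites the three
declared stubs by name; no `sorry` outside the stubs). By cases on the filling: for `|δ| ≥ 1` and
for `δ = 0` the sector ground eigenspace has no proper nonzero subspace at ANY coupling (landed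
`Theorems.irreducibleGround_of_one_le_abs`, `Theorems.irreducibleGround_halfFilling`), so the
midpoint of the window serves; for `0 < |δ| < 1` the window hypothesis puts the datum inside the regime
map (landed `Theorems.blockWindow_regimeMap`, reshape r3), countably many countable exceptional sets
(stub 1) miss a coupling `U` of the window (`Theorems.exists_mem_Ioo_forall_not_mem`, `U₁ < U₂` used here).
Either way, at that `U`, for even `L ≥ max L₀ L₁`: the window hypothesis gives the block average,
stub 3 a good normalised ground state `ψ₀`, irreducibility + stub 2 a scalar `μ`; hence EVERY
normalised sector ground state `ψ` has `⟨ψ, Δ_d†Δ_d ψ⟩ = μ = ⟨ψ₀, Δ_d†Δ_d ψ₀⟩ ≥ c L⁴`, and the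
landed `Theorems.hasLRO_of_forall_groundState_bound` closes the crux BY NAME (these last steps are
the landed closer `Theorems.averageToEvery_of_irreducibleGround`, p148846, applied verbatim).

DISPROOF USED: no `Cruxes/AverageToEvery/Disproof.lean` exists (2026-08-17). From the sibling crux
`BirEveryGroundState`: `not_abstractDarkPartnerExclusion` (stub 1 is typed on the Hubbard torus
pencil with its joint commutant, not abstractly), `not_pointwiseTransfer_L4` (the `∃ L₁` threshold),
`birEveryGroundState_false_without_lt` (`U₁ < U₂` is consumed by the selection step).

Sources: T. Kato, *Perturbation Theory for Linear Operators* (1966) II §6.1; J.-P. Serre, *Linear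
Representations of Finite Groups* §2.2; H. Tasaki (2020) §2.1, §9.3; T. Koma, H. Tasaki, J. Stat.
Phys. 76 (1994) 745 (§0.7, Conj. 10); E. H. Lieb, PRL 62 (1989) 1201.
No definition is introduced; all statements are over existing declarations.
-/

noncomputable section

-- `dupNamespace`: the summit and the problem are both named `HubbardSuperconductivity` (layout D-0022)
set_option linter.dupNamespace false

namespace Summit.HubbardSuperconductivity.HubbardSuperconductivity.Cruxes.AverageToEvery.Birth

open Matrix Finset Filter
open Literature.Probability.LatticeModels Literature.MathematicalPhysics.QuantumLattice
open Summit.HubbardSuperconductivity.HubbardSuperconductivity.Theorems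
  (exists_mem_Ioo_forall_not_mem hasLRO_of_forall_groundState_bound
    irreducibleGround_of_one_le_abs irreducibleGround_halfFilling blockWindow_regimeMap)
open scoped ComplexOrder Matrix Classical

/-! ## The three stubs (signatures free of `let … := …`, each restated verbatim by its proof file) -/

/-- **STUB 1 `stub_liveDopedCountableAccidentalCouplings` — THE BET** (Kato–Rellich genericity of the
DOPED Hubbard torus, window-relative form, fillings `0 < |δ| < 1` only, data inside the regime map only —
reshape r3 of `stub_dopedCountableAccidentalCouplings` (r2), itself the doped restriction of the former
`stub_countableAccidentalCouplings`, whose slices `δ = 0` and `|δ| ≥ 1` are landed theorems; the three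
regime hypotheses `(0 ≤ δ → c ≤ 2(1-δ)(1+δ) ∧ c ≤ 80δ + 640/U₂)`, `c/(10⁵log²(4+32/√c)) ≤ U₁`,
`c ≤ 10⁵U₁log²(4+32/√U₁)` are CONSEQUENCES of the window hypothesis (`Theorems.blockWindow_regimeMap`),
so the stub is the r2 stub restricted to the only data at which its hypothesis can hold). For
`0 < |δ| < 1` inside the regime map, under the window hypothesis of the crux (block ground-state average of `Δ_d† Δ_d` at
least `c L⁴` for all `U ∈ (U₁, U₂)` and all even `L ≥ L₀`), there are a threshold `L₁` and countable
exceptional coupling sets `B L` such that for every even side `L ≥ L₁` and every `U ∈ (U₁, U₂) ∖ B L`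
the sector ground eigenspace `E₀(U, L) = szSector N_L 0 ⊓ ker (H - e₀)` of `H = hubbardTorus 2 L 1 U`
has no subspace other than `⊥` and itself invariant under every matrix commuting with `H`, `N̂`,
`S^z` and `Δ_d† Δ_d`. Not claimed provable now: this is the residual of the crux. Kato (1966) II
§6.1; Koma–Tasaki (1994) Conj. 10. -/
theorem stub_liveDopedCountableAccidentalCouplings :
    ∀ (δ U₁ U₂ c : ℝ) (L₀ : ℕ), 0 < |δ| → |δ| < 1 → 0 < U₁ → U₁ < U₂ → 0 < c →
      (0 ≤ δ → c ≤ 2 * (1 - δ) * (1 + δ) ∧ c ≤ 80 * δ + 640 / U₂) →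
      c / (100000 * Real.log (4 + 32 / Real.sqrt c) ^ 2) ≤ U₁ →
      c ≤ 100000 * U₁ * Real.log (4 + 32 / Real.sqrt U₁) ^ 2 →
      (∀ U ∈ Set.Ioo U₁ U₂, ∀ (L : ℕ) [NeZero L], L₀ ≤ L → Even L →
        c * (L : ℝ) ^ 4 ≤ (((hubbardTorus 2 L 1 U).toBlock
          (fun s : Finset (Orb (FermionTorus 2 L)) => s.card = 2 * ⌊(1 - δ) * (L : ℝ) ^ 2 / 2⌋₊ ∧
            2 * (s.filter fun i => (ofLex i).2 = 0).card = 2 * ⌊(1 - δ) * (L : ℝ) ^ 2 / 2⌋₊)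
          (fun s : Finset (Orb (FermionTorus 2 L)) => s.card = 2 * ⌊(1 - δ) * (L : ℝ) ^ 2 / 2⌋₊ ∧
            2 * (s.filter fun i => (ofLex i).2 = 0).card = 2 * ⌊(1 - δ) * (L : ℝ) ^ 2 / 2⌋₊)).groundStateFunctional
          ((((pairField dWaveFormFactor L)ᴴ * pairField dWaveFormFactor L)).toBlock
          (fun s : Finset (Orb (FermionTorus 2 L)) => s.card = 2 * ⌊(1 - δ) * (L : ℝ) ^ 2 / 2⌋₊ ∧
            2 * (s.filter fun i => (ofLex i).2 = 0).card = 2 * ⌊(1 - δ) * (L : ℝ) ^ 2 / 2⌋₊)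
          (fun s : Finset (Orb (FermionTorus 2 L)) => s.card = 2 * ⌊(1 - δ) * (L : ℝ) ^ 2 / 2⌋₊ ∧
            2 * (s.filter fun i => (ofLex i).2 = 0).card = 2 * ⌊(1 - δ) * (L : ℝ) ^ 2 / 2⌋₊))).re) →
      ∃ L₁ : ℕ, ∃ B : ℕ → Set ℝ, (∀ L, (B L).Countable) ∧
        ∀ (L : ℕ) [NeZero L], L₁ ≤ L → Even L → ∀ U ∈ Set.Ioo U₁ U₂, U ∉ B L →
          ∀ K' : Submodule ℂ (Fock (Orb (FermionTorus 2 L))),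
            K' ≤ szSector (2 * ⌊(1 - δ) * (L : ℝ) ^ 2 / 2⌋₊) 0 ⊓
              Module.End.eigenspace (Matrix.toLin' (hubbardTorus 2 L 1 U))
                ((((hubbardTorus 2 L 1 U).minEnergyOn
                  (szSector (2 * ⌊(1 - δ) * (L : ℝ) ^ 2 / 2⌋₊) 0) : ℝ) : ℂ)) →
            (∀ X : Matrix (Finset (Orb (FermionTorus 2 L))) (Finset (Orb (FermionTorus 2 L))) ℂ,
              X * hubbardTorus 2 L 1 U = hubbardTorus 2 L 1 U * X →
              X * totalNumber = totalNumber * X →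
              X * HubbardWave0.spinZ = HubbardWave0.spinZ * X →
              X * ((pairField dWaveFormFactor L)ᴴ * pairField dWaveFormFactor L) =
                (pairField dWaveFormFactor L)ᴴ * pairField dWaveFormFactor L * X →
              ∀ v ∈ K', X *ᵥ v ∈ K') →
            K' = ⊥ ∨
              K' = szSector (2 * ⌊(1 - δ) * (L : ℝ) ^ 2 / 2⌋₊) 0 ⊓
                Module.End.eigenspace (Matrix.toLin' (hubbardTorus 2 L 1 U))
                  ((((hubbardTorus 2 L 1 U).minEnergyOn
                    (szSector (2 * ⌊(1 - δ) * (L : ℝ) ^ 2 / 2⌋₊) 0) : ℝ) : ℂ)) := by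
  sorry

/-- **STUB 2 `stub_schurScalarOnGround` — SCHUR ON THE JOINT COMMUTANT** (theorem-grade). At any
coupling `U`, any side `L` and any particle number `N`: if the sector ground eigenspace
`E₀ = szSector N 0 ⊓ ker (H - e₀)` of `H = hubbardTorus 2 L 1 U` (`e₀ = minEnergyOn H (szSector N 0)`)
is irreducible under the matrices commuting with `H`, `N̂`, `S^z` and `Y = Δ_d† Δ_d`, then `Y` has
scalar matrix elements on `E₀`: `⟨w, Y v⟩ = μ ⟨w, v⟩` for all `v, w ∈ E₀` (the commutant preserves
`E₀`, is closed under `ᴴ`, and commutes with `Y`; Schur for the compression `P Y P`). Serre,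
*Linear Representations of Finite Groups* §2.2; Tasaki (2020) §9.3. Leans on
`Theorems.exists_scalar_matrixElements_of_irreducible`,
`Theorems.mulVec_mem_groundEigenspace_of_commute`, `Theorems.conjTranspose_mem_symmetries`. -/
theorem stub_schurScalarOnGround :
    ∀ (U : ℝ) (L N : ℕ) [NeZero L],
      (∀ K' : Submodule ℂ (Fock (Orb (FermionTorus 2 L))),
        K' ≤ szSector N 0 ⊓
          Module.End.eigenspace (Matrix.toLin' (hubbardTorus 2 L 1 U))
            ((((hubbardTorus 2 L 1 U).minEnergyOn (szSector N 0) : ℝ) : ℂ)) →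
        (∀ X : Matrix (Finset (Orb (FermionTorus 2 L))) (Finset (Orb (FermionTorus 2 L))) ℂ,
          X * hubbardTorus 2 L 1 U = hubbardTorus 2 L 1 U * X →
          X * totalNumber = totalNumber * X →
          X * HubbardWave0.spinZ = HubbardWave0.spinZ * X →
          X * ((pairField dWaveFormFactor L)ᴴ * pairField dWaveFormFactor L) =
            (pairField dWaveFormFactor L)ᴴ * pairField dWaveFormFactor L * X →
          ∀ v ∈ K', X *ᵥ v ∈ K') →
        K' = ⊥ ∨
          K' = szSector N 0 ⊓
            Module.End.eigenspace (Matrix.toLin' (hubbardTorus 2 L 1 U))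
              ((((hubbardTorus 2 L 1 U).minEnergyOn (szSector N 0) : ℝ) : ℂ))) →
      ∃ μ : ℂ,
        ∀ v ∈ szSector N 0 ⊓
            Module.End.eigenspace (Matrix.toLin' (hubbardTorus 2 L 1 U))
              ((((hubbardTorus 2 L 1 U).minEnergyOn (szSector N 0) : ℝ) : ℂ)),
          ∀ w ∈ szSector N 0 ⊓
              Module.End.eigenspace (Matrix.toLin' (hubbardTorus 2 L 1 U))
                ((((hubbardTorus 2 L 1 U).minEnergyOn (szSector N 0) : ℝ) : ℂ)),
            star w ⬝ᵥ ((pairField dWaveFormFactor L)ᴴ * pairField dWaveFormFactor L) *ᵥ v =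
              μ * (star w ⬝ᵥ v) :=
  -- LANDED (p147012): `Theorems/LogColdTorusAverageToEveryStubSchurScalarOnGround.lean`
  Summit.HubbardSuperconductivity.HubbardSuperconductivity.Theorems.stub_schurScalarOnGround

/-- **STUB 3 `stub_blockAverageWitness` — THE BLOCK ↔ FOCK DICTIONARY** (provable now). At any
coupling `U`, any side `L`, any `n` and any `c > 0`: if the tracial ground-state functional of the
compression of `H = hubbardTorus 2 L 1 U` to the `(2n, S^z = 0)` occupation block (`#s = 2n`,
`2·#{↑ ∈ s} = 2n`) gives the compressed `Δ_d† Δ_d` a real part `≥ c L⁴` (the crux's window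
hypothesis at `(U, L)`, with `n = ⌊(1-δ)L²/2⌋`), then SOME normalised sector ground state `ψ` of `H`
in the Fock space (`IsGroundStateInSector H (2n) 0 ψ`, `‖ψ‖ = 1`) has `c L⁴ ≤ re ⟨ψ, Δ_d† Δ_d ψ⟩`.
(`c > 0` makes the block non-empty, else the functional is the junk `0`; the functional is the mean
over an orthonormal basis of the block ground space — pigeonhole,
`exists_unit_le_re_of_trace_projMatrix_map`; extension by zero of a block ground vector is a sector
ground state with the same norm and expectation: `szSector (2n) 0` is the coordinate subspace of
the block (`mem_szSector_two_mul_zero_iff` with `JosephsonMirror.card_upPart_eq_card_filter`) and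
the block ground energy is `minEnergyOn H (szSector (2n) 0)`
(`CwThesis.groundEnergy_toBlock_eq_minEnergyOn`).) Tasaki (2020) §2.1–2.2; Lieb, PRL 62 (1989) 1201. -/
theorem stub_blockAverageWitness :
    ∀ (U c : ℝ) (L n : ℕ) [NeZero L], 0 < c →
      c * (L : ℝ) ^ 4 ≤ (((hubbardTorus 2 L 1 U).toBlock
          (fun s : Finset (Orb (FermionTorus 2 L)) => s.card = 2 * n ∧
            2 * (s.filter fun i => (ofLex i).2 = 0).card = 2 * n)
          (fun s : Finset (Orb (FermionTorus 2 L)) => s.card = 2 * n ∧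
            2 * (s.filter fun i => (ofLex i).2 = 0).card = 2 * n)).groundStateFunctional
          ((((pairField dWaveFormFactor L)ᴴ * pairField dWaveFormFactor L)).toBlock
          (fun s : Finset (Orb (FermionTorus 2 L)) => s.card = 2 * n ∧
            2 * (s.filter fun i => (ofLex i).2 = 0).card = 2 * n)
          (fun s : Finset (Orb (FermionTorus 2 L)) => s.card = 2 * n ∧
            2 * (s.filter fun i => (ofLex i).2 = 0).card = 2 * n))).re →
      ∃ ψ : Fock (Orb (FermionTorus 2 L)),
        IsGroundStateInSector (hubbardTorus 2 L 1 U) (2 * n) 0 ψ ∧ star ψ ⬝ᵥ ψ = 1 ∧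
        c * (L : ℝ) ^ 4 ≤
          (star ψ ⬝ᵥ ((pairField dWaveFormFactor L)ᴴ * pairField dWaveFormFactor L) *ᵥ ψ).re :=
  -- LANDED (p148193): `Theorems/LogColdTorusAverageToEveryStubBlockAverageWitness.lean`
  Summit.HubbardSuperconductivity.HubbardSuperconductivity.Theorems.stub_blockAverageWitness

/-! ## The composition: the three stubs imply the crux, by name -/

/-- **`AverageToEvery_of`** — the composition `stub_liveDopedCountableAccidentalCouplings → stub_schurScalarOnGround →
stub_blockAverageWitness → LogColdTorus.AverageToEvery` (A12: concludes the crux BY NAME, takes no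
hypotheses and cites the DECLARED stubs by name; its only `sorryAx` dependence is through stub 1).
First a coupling `U ∈ (U₁, U₂)` with eventually-irreducible sector ground eigenspaces is chosen BY
CASES ON THE FILLING: for `|δ| ≥ 1` (LANDED `Theorems.irreducibleGround_of_one_le_abs`: empty or
one-dimensional sectors) and for `δ = 0` (LANDED `Theorems.irreducibleGround_halfFilling`: Lieb's
Theorem 2) any coupling serves and the midpoint is taken; for `0 < |δ| < 1` the window hypothesis
places the datum inside the regime map (LANDED `Theorems.blockWindow_regimeMap`: Yang, carrier, pairing
cost), which feeds stub 1, and the coupling is chosen outside all the countable exceptional sets `B L` of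
stub 1 (`Theorems.exists_mem_Ioo_forall_not_mem`; this is where `U₁ < U₂` is consumed). Then, for even `L ≥ max L₀ L₁`, the window hypothesis at
`(U, L)` yields (stub 3) a normalised sector ground state `ψ₀` with `c L⁴ ≤ re ⟨ψ₀, Δ_d†Δ_d ψ₀⟩`,
irreducibility of `E₀(U, L)` and a scalar `μ` for `Δ_d†Δ_d` on `E₀(U, L)` (stub 2), so every
normalised sector ground state `ψ` has `re ⟨ψ, Δ_d†Δ_d ψ⟩ = re μ = re ⟨ψ₀, Δ_d†Δ_d ψ₀⟩ ≥ c L⁴`; the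
landed `Theorems.hasLRO_of_forall_groundState_bound` turns this every-ground-state bound at one
coupling into the summit-format long-range order of every admissible sequence. [folklore] -/
theorem AverageToEvery_of :
    Summit.HubbardSuperconductivity.HubbardSuperconductivity.Theses.LogColdTorus.AverageToEvery := by
  intro δ U₁ U₂ c L₀ hU₁ hU₁₂ hc hyp
  -- a coupling of the window with eventually-irreducible sector ground eigenspaces, by cases on `δ`
  obtain ⟨U, hU, L₁, hirr⟩ : ∃ U ∈ Set.Ioo U₁ U₂, ∃ L₁ : ℕ, ∀ (L : ℕ) [NeZero L], L₁ ≤ L → Even L →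
      ∀ K' : Submodule ℂ (Fock (Orb (FermionTorus 2 L))),
        K' ≤ szSector (2 * ⌊(1 - δ) * (L : ℝ) ^ 2 / 2⌋₊) 0 ⊓
              Module.End.eigenspace (Matrix.toLin' (hubbardTorus 2 L 1 U))
                ((((hubbardTorus 2 L 1 U).minEnergyOn
                  (szSector (2 * ⌊(1 - δ) * (L : ℝ) ^ 2 / 2⌋₊) 0) : ℝ) : ℂ)) →
        (∀ X : Matrix (Finset (Orb (FermionTorus 2 L))) (Finset (Orb (FermionTorus 2 L))) ℂ,
          X * hubbardTorus 2 L 1 U = hubbardTorus 2 L 1 U * X →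
          X * totalNumber = totalNumber * X →
          X * HubbardWave0.spinZ = HubbardWave0.spinZ * X →
          X * ((pairField dWaveFormFactor L)ᴴ * pairField dWaveFormFactor L) =
            (pairField dWaveFormFactor L)ᴴ * pairField dWaveFormFactor L * X →
          ∀ v ∈ K', X *ᵥ v ∈ K') →
        K' = ⊥ ∨ K' = szSector (2 * ⌊(1 - δ) * (L : ℝ) ^ 2 / 2⌋₊) 0 ⊓
              Module.End.eigenspace (Matrix.toLin' (hubbardTorus 2 L 1 U))
                ((((hubbardTorus 2 L 1 U).minEnergyOn
                  (szSector (2 * ⌊(1 - δ) * (L : ℝ) ^ 2 / 2⌋₊) 0) : ℝ) : ℂ)) := by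
    have hmid : (U₁ + U₂) / 2 ∈ Set.Ioo U₁ U₂ := ⟨by linarith, by linarith⟩
    by_cases h1 : 1 ≤ |δ|
    · -- `|δ| ≥ 1`: empty or one-dimensional sectors, any coupling (LANDED, p152046)
      obtain ⟨L₁, hL₁⟩ := irreducibleGround_of_one_le_abs h1
      exact ⟨(U₁ + U₂) / 2, hmid, L₁, fun L _ hL hLe K' hK' _ => hL₁ _ L hL hLe K' hK'⟩
    · by_cases h0 : δ = 0
      · -- half filling: Lieb's Theorem 2, any `U > 0` (LANDED, p151783)
        subst h0
        exact ⟨(U₁ + U₂) / 2, hmid, 0, fun L _ _ hLe K' hK' _ =>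
          irreducibleGround_halfFilling (hU₁.trans hmid.1) L hLe K' hK'⟩
      · -- the doped range `0 < |δ| < 1`: the datum lies in the regime map (LANDED, p163215),
        -- then STUB 1, and a coupling missing all its exceptional sets
        have hlt1 : |δ| < 1 := not_le.mp h1
        have hδm : -1 ≤ δ := by linarith [neg_abs_le δ]
        have hδ1 : δ ≤ 1 := by linarith [le_abs_self δ]
        have hreg := blockWindow_regimeMap hδm hδ1 hU₁ hU₁₂ hc
          (fun U hU L _ hL hLe => hyp U hU L hL hLe)
        obtain ⟨L₁, B, hBc, hgood⟩ := stub_liveDopedCountableAccidentalCouplings δ U₁ U₂ c L₀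
          (abs_pos.mpr h0) hlt1 hU₁ hU₁₂ hc hreg.1 hreg.2.1 hreg.2.2 hyp
        obtain ⟨U, hU, hUB⟩ := exists_mem_Ioo_forall_not_mem hU₁₂ B hBc
        exact ⟨U, hU, L₁, fun L _ hL hLe => hgood L hL hLe U hU (hUB L)⟩
  refine ⟨U, hU, fun N ψ hadm =>
    hasLRO_of_forall_groundState_bound U δ c hc (max L₀ L₁) ?_ N ψ hadm⟩
  intro L _ hL hLe φ hgs hunit
  -- (i) the window hypothesis at `(U, L)`: block ground-state average `≥ c L⁴`
  have havg := hyp U hU L ((le_max_left _ _).trans hL) hLe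
  -- (ii) one normalised sector ground state carrying it (STUB 3, block ↔ Fock dictionary)
  obtain ⟨φ₀, hgs₀, hunit₀, hle₀⟩ :=
    stub_blockAverageWitness U c L ⌊(1 - δ) * (L : ℝ) ^ 2 / 2⌋₊ hc havg
  -- (iii)+(iv) irreducibility at `(U, L)` and Schur (STUB 2): `Δ_d† Δ_d` is scalar on `E₀(U, L)`
  obtain ⟨μ, hμ⟩ := stub_schurScalarOnGround U L (2 * ⌊(1 - δ) * (L : ℝ) ^ 2 / 2⌋₊)
    (hirr L ((le_max_right _ _).trans hL) hLe)
  -- (v) sector ground states lie in `E₀(U, L)`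
  have hmem : ∀ χ : Fock (Orb (FermionTorus 2 L)),
      IsGroundStateInSector (hubbardTorus 2 L 1 U) (2 * ⌊(1 - δ) * (L : ℝ) ^ 2 / 2⌋₊) 0 χ →
      χ ∈ szSector (2 * ⌊(1 - δ) * (L : ℝ) ^ 2 / 2⌋₊) 0 ⊓
        Module.End.eigenspace (Matrix.toLin' (hubbardTorus 2 L 1 U))
          (((hubbardTorus 2 L 1 U).minEnergyOn
            (szSector (2 * ⌊(1 - δ) * (L : ℝ) ^ 2 / 2⌋₊) 0) : ℝ) : ℂ) := by
    intro χ hχ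
    refine Submodule.mem_inf.mpr ⟨hχ.1, ?_⟩
    rw [Module.End.mem_eigenspace_iff, Matrix.toLin'_apply]
    exact hχ.2.2
  -- (vi) every ground state carries the expectation of the good one
  have e1 := hμ φ (hmem φ hgs) φ (hmem φ hgs)
  have e0 := hμ φ₀ (hmem φ₀ hgs₀) φ₀ (hmem φ₀ hgs₀)
  rw [hunit, mul_one] at e1
  rw [hunit₀, mul_one] at e0
  rw [e1]
  rw [e0] at hle₀
  exact hle₀

end Summit.HubbardSuperconductivity.HubbardSuperconductivity.Cruxes.AverageToEvery.Birth

end
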